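import Summits.KontsevichZagierPeriods.KontsevichZagierPeriods.Theses.HurwitzMicroSectors
import Summits.KontsevichZagierPeriods.KontsevichZagierPeriods.Theorems.HurwitzMicroSectorsAperySectorThreeTwo
import Summits.KontsevichZagierPeriods.KontsevichZagierPeriods.Theorems.HurwitzMicroSectorsSectorTwoSix
import Literature.NumberTheory.Transcendental.KZKernelConjectureForms

/-!
# `HurwitzSectorComplement` (stmt-KontsevichZagierPeriods-14341) — negative side, I: the crux IS the summit

Refuter (`cdisprove`, cycle 1) by-products for the crux
`HurwitzSectorComplement := SectorTwoSix → AperySectorThreeTwo → NormalFormPrinciple` of route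
`HurwitzMicroSectors` (landed copy of §§1–4, 6 of the crux work file
`Cruxes/HurwitzSectorComplement/Disproof.lean`; the refuted strengthenings are in the sibling files
`Negative/FiniteRungTable.lean` and `Negative/DimZero.lean`). Nothing here asserts a route item positively.

* §1 `crux_iff_statement : HurwitzSectorComplement ↔ KontsevichZagierPeriods` — both antecedents are
  tree theorems (`AperySectorThreeTwo_of`, item 3873; `SectorTwoSix_of`, item 3870) and
  `NormalFormPrinciple ↔ KontsevichZagierPeriods` (`nfp_iff_statement`: `𝒩 = rational reps` / the route's
  deciding theorem `closes`). Hence `crux_iff_nfp`, `crux_iff_kernel` (`ker eval = relations`),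
  `not_crux_iff : ¬crux ↔ ¬summit`, `not_crux_iff_exists : ¬crux ↔ ∃ c, eval c = 0 ∧ c ∉ relations`.
* §2 load-bearing analysis of the crux's hypotheses: both idle (`crux_iff_withoutH1/H2`); no
  `_false_without_` theorem short of `¬summit` (`not_withoutH1_iff`, `not_withoutH2_iff`).
* §3 template of the only possible refutation: `not_crux_of_separating_invariant` (an additive
  move-invariant not factoring through `eval`), and its converse `exists_separating_of_not_crux`.
* §5 sanity: each half of `NormalFormPrinciple` alone is trivially satisfiable (`rigid_empty`,
  `reducing_rational`); the content is the conjunction, which for the rational family is the summit.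

Sources: M. Kontsevich, D. Zagier, *Periods* (2001), §1.2 Conjecture 1; F. Calegari, V. Dimitrov,
Y. Tang, arXiv:2408.15403 (2024), Thm 1 (behind `SectorTwoSix_of`).
-/

noncomputable section

namespace Summit.KontsevichZagierPeriods.Theorems.HurwitzSectorComplement.Negative

open Set MeasureTheory Polynomial
open Literature.NumberTheory.Transcendental
open Literature.NumberTheory.Transcendental.KZ
open Literature.ModelTheory.ExponentialFields (isSemialgebraic_univ IsSemialgebraic)
open Summit.KontsevichZagierPeriods.KontsevichZagierPeriods.Theses.HurwitzMicroSectors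
  (HurwitzSectorComplement SectorTwoSix AperySectorThreeTwo NormalFormPrinciple closes)

/-! ## §1 The crux is the summit statement -/

/-- **The route's target restates the summit**: `NormalFormPrinciple ↔ KontsevichZagierPeriods`
(→ the route's deciding theorem `closes`; ← take `𝒩 = rational representations`). [folklore] -/
theorem nfp_iff_statement : NormalFormPrinciple ↔ KontsevichZagierPeriods :=
  ⟨fun h => closes h, fun h => ⟨fun _ => {N | N.IsRational},
    fun _ _ N N' hN hN' hv => h N N' hN hN' hv, fun n r hr => ⟨n, r, hr, Equivalent.refl r⟩⟩⟩

/-- Without any input on `SectorTwoSix`: the crux is exactly "`SectorTwoSix` is summit-strength"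
(`AperySectorThreeTwo` is the tree theorem `AperySectorThreeTwo_of`). [folklore] -/
theorem crux_iff_imp : HurwitzSectorComplement ↔ (SectorTwoSix → KontsevichZagierPeriods) :=
  ⟨fun h h1 => nfp_iff_statement.mp
      (h h1 Summit.KontsevichZagierPeriods.Theorems.AperySectorThreeTwo.AperySectorThreeTwo_of),
    fun h h1 _ => nfp_iff_statement.mpr (h h1)⟩

/-- **The crux IS the summit statement** (Conjecture 1 of Kontsevich–Zagier over `KZ.relations`):
both antecedents are tree theorems — `AperySectorThreeTwo_of` (item 3873) and `SectorTwoSix_of`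
(item 3870). [folklore] -/
theorem crux_iff_statement : HurwitzSectorComplement ↔ KontsevichZagierPeriods := by
  rw [crux_iff_imp]
  exact ⟨fun h => h Summit.KontsevichZagierPeriods.Theorems.HurwitzMicroSectorsSectorTwoSix.SectorTwoSix_of,
    fun h _ => h⟩

/-- The crux is its own conclusion. [folklore] -/
theorem crux_iff_nfp : HurwitzSectorComplement ↔ NormalFormPrinciple :=
  crux_iff_statement.trans nfp_iff_statement.symm

/-- … equivalently the kernel form `ker KZ.eval = KZ.relations` (tree `kzKernelConjecture_iff_isRational`). [folklore] -/
theorem crux_iff_kernel : HurwitzSectorComplement ↔ KZKernelConjecture :=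
  crux_iff_statement.trans kzKernelConjecture_iff_isRational.symm

/-- **Anatomy of a refutation**: `¬ crux` is precisely a disproof of the summit. [folklore] -/
theorem not_crux_iff : ¬ HurwitzSectorComplement ↔ ¬ KontsevichZagierPeriods :=
  not_congr crux_iff_statement

/-- … i.e. an element of `ker eval` outside `relations`. [folklore] -/
theorem not_crux_iff_exists :
    ¬ HurwitzSectorComplement ↔ ∃ c : FormalRep, eval c = 0 ∧ c ∉ relations := by
  rw [not_congr crux_iff_kernel]
  unfold KZKernelConjecture
  push Not
  rfl

/-! ## §2 Load-bearing analysis of the crux's hypotheses: both are idle -/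

/-- Dropping `H₁ = SectorTwoSix` changes nothing. [folklore] -/
theorem crux_iff_withoutH1 : HurwitzSectorComplement ↔ (AperySectorThreeTwo → NormalFormPrinciple) := by
  rw [crux_iff_nfp]
  exact ⟨fun h _ => h,
    fun h => h Summit.KontsevichZagierPeriods.Theorems.AperySectorThreeTwo.AperySectorThreeTwo_of⟩

/-- Dropping `H₂ = AperySectorThreeTwo` changes nothing. [folklore] -/
theorem crux_iff_withoutH2 : HurwitzSectorComplement ↔ (SectorTwoSix → NormalFormPrinciple) :=
  ⟨fun h h1 => h h1 Summit.KontsevichZagierPeriods.Theorems.AperySectorThreeTwo.AperySectorThreeTwo_of,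
    fun h h1 _ => h h1⟩

/-- No `_false_without_H₁` theorem exists short of `¬ summit`. [folklore] -/
theorem not_withoutH1_iff : ¬ (AperySectorThreeTwo → NormalFormPrinciple) ↔ ¬ KontsevichZagierPeriods :=
  (not_congr crux_iff_withoutH1).symm.trans not_crux_iff

/-- No `_false_without_H₂` theorem exists short of `¬ summit`. [folklore] -/
theorem not_withoutH2_iff : ¬ (SectorTwoSix → NormalFormPrinciple) ↔ ¬ KontsevichZagierPeriods :=
  (not_congr crux_iff_withoutH2).symm.trans not_crux_iff

/-! ## §3 The only weapon: a separating additive invariant (template) -/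

/-- TEMPLATE of a refutation of the crux (= of the summit): an additive invariant `J` of `FormalRep`
vanishing on the four move sets and a formal combination of value `0` on which `J` does not vanish.
Soundness (`relations_le_ker_eval_holds`) says `eval` is such a `J` except for the last clause. [folklore] -/
theorem not_crux_of_separating_invariant {A : Type*} [AddCommGroup A] (J : FormalRep →+ A)
    (hJ : ∀ x ∈ domainAddRel ∪ integrandAddRel ∪ changeOfVariablesRel ∪ newtonLeibnizRel, J x = 0)
    (c : FormalRep) (hc : eval c = 0) (hJc : J c ≠ 0) : ¬ HurwitzSectorComplement := fun h => by
  have hker : relations ≤ J.ker := (AddSubgroup.closure_le _).mpr fun x hx => hJ x hx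
  exact hJc (hker (crux_iff_kernel.mp h c hc))

/-- Conversely every refutation of the crux IS such a pair (`J` the quotient map by `relations`). [folklore] -/
theorem exists_separating_of_not_crux (h : ¬ HurwitzSectorComplement) :
    ∃ c : FormalRep, eval c = 0 ∧ c ∉ relations :=
  not_crux_iff_exists.mp h

/-! ## §5 Sanity: each half of `NormalFormPrinciple` alone is trivial -/

/-- Rigidity alone is trivially satisfiable (`𝒩 = ∅`). [folklore] -/
theorem rigid_empty :
    ∀ (n m : ℕ) (N : IntegralRep n) (N' : IntegralRep m), N ∈ (fun _ => (∅ : Set (IntegralRep _))) n →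
      N' ∈ (fun _ => (∅ : Set (IntegralRep _))) m → N.value = N'.value → Equivalent N N' :=
  fun _ _ _ _ hN _ _ => absurd hN (Set.notMem_empty _)

/-- Reduction alone is trivially satisfiable (`𝒩 = rational representations`). [folklore] -/
theorem reducing_rational :
    ∀ (n : ℕ) (r : IntegralRep n), r.IsRational →
      ∃ (m : ℕ) (N : IntegralRep m), N ∈ (fun k => {N : IntegralRep k | N.IsRational}) m ∧ Equivalent r N :=
  fun n r hr => ⟨n, r, hr, Equivalent.refl r⟩

end Summit.KontsevichZagierPeriods.Theorems.HurwitzSectorComplement.Negative
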